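/-
Origin: expansion seat `planner-pub-hodgecm-pv14-g5-0`, handover #6 2026-08-18T10:20:46Z (`HOME/pub-hodgecm-pv14-g5/lean/Pv14g5/WeilThetaModelHeisenbergFourier.lean`, md5 fc3b6dcb, 205 lines);
landed by the gen-7 packager in gate run 28 as `HodgeCM/Automorphic/WeilThetaModelHeisenbergFourier.lean` (import ^import Pv14g5\.→import HodgeCM.Automorphic. ×2).
-/
/-
Origin: HOME/pub-hodgecm-pv14-g5/lean/Pv14g5/WeilThetaModelHeisenbergFourier.lean — session planner-pub-hodgecm-pv14-g5-0
(unit pub-hodgecm-pv14-g5, DAG-node prover #14 gen 5).  Intended final place: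
`HodgeCM/Automorphic/WeilThetaModelHeisenbergFourier.lean` (namespace `HodgeCM.SchwartzWeil`).
PACKAGER: rewrite `import Pv14g5.WeilThetaModelHeisenberg` to `import HodgeCM.Automorphic.WeilThetaModelHeisenberg` and
`import Pv14g5.PoissonSummationDual` to `import HodgeCM.Automorphic.PoissonSummationDual` (this seat's HANDOVER #5, #2).
Asserts nothing (no `axiom`, no new constants).
-/
import Summits.HodgeConjecture.HodgeCM.Automorphic.WeilThetaModelHeisenberg_2
import Summits.HodgeConjecture.HodgeCM.Automorphic.PoissonSummationDual

/-!
# The Weyl element acts on the Heisenberg theta model: `𝓕 ∘ ρ_m(h) = ρ_m(σ h) ∘ 𝓕` and `Θ^{L*}_{𝓕Φ} ∘ σ = covol(L) · Θ^{L}_Φ`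

GAPS `pv14g4-K1` (b) / `pv14g5-K3`: the Weyl element `σ` of `Sp(V ⊕ V)` is not adjoined to the model's group (no
`Mp(W)` in Mathlib).  What IS available in the kernel, and proved here, is its action BY TRANSPORT OF STRUCTURE on
the Heisenberg model of `WeilThetaModelHeisenberg` (#5):

* `Heis.weyl m hm : Heis V →* Heis V` (`m ≠ 0`) — the automorphism `σ_m(a, b, u) = (m b, -a/m, u 𝐞(⟪a, b⟫))` of the
  polarised Heisenberg group (the symplectic rotation `(a, b) ↦ (b, -a)` rescaled to weight `m`, with the cocycle
  correction forced by the polarisation); `weyl_weyl : σ_m² = (a, b, u) ↦ (-a, -b, u)`; `weyl_center`.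
* **`fourier_repCLM : 𝓕 (ρ_m(h) Φ) = ρ_m(σ_m h) (𝓕 Φ)`** — the Fourier transform of `𝓢(V, ℂ)` INTERTWINES the
  weight-`m` Schrödinger representation with its `σ_m`-twist (from #4: `𝓕 ∘ τ_a = M_{-a} ∘ 𝓕`, `𝓕 ∘ M_b = τ_b ∘ 𝓕`,
  and the commutation relation).  This is `ρ(σ) ρ(h) ρ(σ)⁻¹ = ρ(σ h σ⁻¹)` with `ρ(σ) := 𝓕` [We64 n° 13–14], i.e.
  the Weyl element realised as an operator normalising the Heisenberg representation — KERNEL.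
* **`thetaH_fourier_weyl : Θ^{L*}_{𝓕Φ}(σ_m h) = covol(V/L) · Θ^{L}_Φ(h)`** for every `h ∈ Heis V` (Poisson summation
  in any rank, #1/#2, applied to `ρ_m(h) Φ`) — Weil's (39) of n° 41 on the WHOLE Heisenberg group, not only at
  `h = 1` (#3); self-dual form `thetaH_fourier_weyl_of_dualLattice_eq : L* = L → Θ_{𝓕Φ}(σ_m h) = Θ_Φ(h)`;
  `weyl_mem_arith : σ_m(arith L) ⊆ arith L*` (the automorphism exchanges the two halves `L`, `L*/m` of the
  arithmetic subgroup, #1 `L** = L`); and on prl1-g4's record: `heisenbergModel_θ_mk_fourier`.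

LABELS.  KERNEL (Mathlib + this seat's #1, #2, #4, #5 + pv14-g4 #1, #2).  NOT CLAIMED: an `Mp`/`Sp`-valued
extension of the model's group containing `σ` (the statement here is the intertwining identity and the theta
functional equation, which is what such an extension would be used for at the real place); finite places.
-/

set_option autoImplicit false

noncomputable section

open MeasureTheory
open scoped RealInnerProductSpace FourierTransform SchwartzMap

namespace HodgeCM
namespace SchwartzWeil

/-! ## 1. The Weyl automorphism `σ_m` of the Heisenberg group -/

namespace Heis

variable {V : Type*} [NormedAddCommGroup V] [InnerProductSpace ℝ V]

/-- **The Weyl automorphism** `σ_m(a, b, u) = (m b, -m⁻¹ a, u 𝐞(⟪a, b⟫))` of `Heis V` (`m ≠ 0`). -/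
def weyl (m : ℤ) (hm : m ≠ 0) : Heis V →* Heis V :=
  MonoidHom.mk' (fun h => ⟨(m : ℝ) • h.b, -((m : ℝ)⁻¹ • h.a), h.u * 𝐞 ⟪h.a, h.b⟫⟩) (by
    have hm' : (m : ℝ) ≠ 0 := Int.cast_ne_zero.mpr hm
    intro h h'
    ext
    · simp only [mul_a, mul_b, smul_add]
    · simp only [mul_a, mul_b, smul_add, neg_add]
    · simp only [mul_u, mul_a, mul_b, inner_add_left, inner_add_right, inner_neg_right, real_inner_smul_left,
        real_inner_smul_right, inv_mul_cancel_left₀ hm', real_inner_comm h'.a h.b, AddChar.map_add_eq_mul,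
        AddChar.map_neg_eq_inv, Circle.coe_mul, Circle.coe_inv]
      field_simp)

/-- (Ported verbatim from the HodgeCMPerL package; no docstring in the source.) -/
@[simp] theorem weyl_a (m : ℤ) (hm : m ≠ 0) (h : Heis V) : (weyl m hm h).a = (m : ℝ) • h.b := rfl
/-- (Ported verbatim from the HodgeCMPerL package; no docstring in the source.) -/
@[simp] theorem weyl_b (m : ℤ) (hm : m ≠ 0) (h : Heis V) : (weyl m hm h).b = -((m : ℝ)⁻¹ • h.a) := rfl
/-- (Ported verbatim from the HodgeCMPerL package; no docstring in the source.) -/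
@[simp] theorem weyl_u (m : ℤ) (hm : m ≠ 0) (h : Heis V) : (weyl m hm h).u = h.u * 𝐞 ⟪h.a, h.b⟫ := rfl

/-- (Ported verbatim from the HodgeCMPerL package; no docstring in the source.) -/
theorem weyl_center (m : ℤ) (hm : m ≠ 0) (z : Circle) : weyl m hm (center z : Heis V) = center z := by
  ext
  · simp only [weyl_a, center_b, smul_zero, center_a]
  · simp only [weyl_b, center_a, smul_zero, neg_zero, center_b]
  · simp only [weyl_u, center_u, center_a, center_b, inner_zero_left, AddChar.map_zero_eq_one, mul_one]

/-- `σ_m² = ` the central symmetry `(a, b, u) ↦ (-a, -b, u)` (so `σ_m⁴ = 1`). -/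
theorem weyl_weyl (m : ℤ) (hm : m ≠ 0) (h : Heis V) : weyl m hm (weyl m hm h) = ⟨-h.a, -h.b, h.u⟩ := by
  have hm' : (m : ℝ) ≠ 0 := Int.cast_ne_zero.mpr hm
  ext
  · simp only [weyl_a, weyl_b, smul_neg, smul_smul, mul_inv_cancel₀ hm', one_smul]
  · simp only [weyl_b, weyl_a, smul_smul, inv_mul_cancel₀ hm', one_smul]
  · simp only [weyl_u, weyl_a, weyl_b, inner_neg_right, real_inner_smul_left, real_inner_smul_right,
      inv_mul_cancel_left₀ hm', real_inner_comm h.a h.b, AddChar.map_neg_eq_inv, mul_inv_cancel_right]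

end Heis

/-! ## 2. The Fourier transform intertwines `ρ_m` with its Weyl twist -/

section Intertwine

variable (V : Type) [NormedAddCommGroup V] [InnerProductSpace ℝ V] [FiniteDimensional ℝ V] [MeasurableSpace V]
  [BorelSpace V] (m : ℤ)

omit [FiniteDimensional ℝ V] [MeasurableSpace V] [BorelSpace V] in
/-- The phase identity behind the intertwining. -/
theorem weyl_phase (hm : m ≠ 0) (a b x : V) (u : Circle) :
    (u : ℂ) ^ m * (𝐞 ⟪-a, x - (m : ℝ) • b⟫ : ℂ) =
      ((u * 𝐞 ⟪a, b⟫ : Circle) : ℂ) ^ m * (𝐞 ⟪(m : ℝ) • -(((m : ℝ)⁻¹) • a), x⟫ : ℂ) := by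
  have hm' : (m : ℝ) ≠ 0 := Int.cast_ne_zero.mpr hm
  have h1 : (m : ℝ) • -(((m : ℝ)⁻¹) • a) = -a := by
    rw [smul_neg, smul_smul, mul_inv_cancel₀ hm', one_smul]
  have h2 : ⟪-a, x - (m : ℝ) • b⟫ = m • ⟪a, b⟫ + ⟪-a, x⟫ := by
    rw [inner_neg_left, inner_neg_left, inner_sub_right, real_inner_smul_right, zsmul_eq_mul]
    ring
  rw [h1, h2, AddChar.map_add_eq_mul, AddChar.map_zsmul_eq_zpow, Circle.coe_mul, Circle.coe_mul, mul_zpow,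
    Circle.coe_zpow, mul_assoc]

/-- **`𝓕 ∘ ρ_m(h) = ρ_m(σ_m h) ∘ 𝓕`** on `𝓢(V, ℂ)`: the Fourier transform intertwines the weight-`m` Schrödinger
representation of the Heisenberg group with its twist by the Weyl automorphism. -/
theorem fourier_repCLM (hm : m ≠ 0) (h : Heis V) (Φ : 𝓢(V, ℂ)) :
    𝓕 (repCLM V m h Φ) = repCLM V m (Heis.weyl m hm h) (𝓕 Φ) := by
  have e1 : repCLM V m h Φ =
      ((h.u ^ m : Circle) : ℂ) • modCLM V ((m : ℝ) • h.b) (SchwartzMap.compSubConstCLM ℂ h.a Φ) := rfl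
  rw [e1, FourierTransform.fourier_smul, fourier_modCLM, fourier_compSubConstCLM]
  ext x
  simp only [smul_apply, smul_eq_mul, SchwartzMap.compSubConstCLM_apply, modCLM_apply, repCLM_apply,
    Heis.weyl_u, Heis.weyl_b, Heis.weyl_a, Circle.coe_zpow]
  linear_combination (𝓕 Φ) (x - (m : ℝ) • h.b) * weyl_phase V m hm h.a h.b x h.u

/-- The same for the bundled representation. -/
theorem fourier_rep (hm : m ≠ 0) (h : Heis V) (Φ : 𝓢(V, ℂ)) :
    𝓕 (rep V m h Φ) = rep V m (Heis.weyl m hm h) (𝓕 Φ) :=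
  fourier_repCLM V m hm h Φ

end Intertwine

/-! ## 3. The theta functional equation on the Heisenberg group -/

section ThetaFE

variable (V : Type) [NormedAddCommGroup V] [InnerProductSpace ℝ V] [FiniteDimensional ℝ V] [MeasurableSpace V]
  [BorelSpace V] (L : Submodule ℤ V) (m : ℤ)

/-- (Ported verbatim from the HodgeCMPerL package; no docstring in the source.) -/
theorem thetaH_congr {N : Submodule ℤ V} (h : N = L) : thetaH V N m = thetaH V L m := by
  subst h
  rfl

variable [DiscreteTopology L] [IsZLattice ℝ L]

/-- **Weil's (39) on the whole Heisenberg group**: `Θ^{L*}_{𝓕Φ}(σ_m h) = covol(V/L) · Θ^{L}_Φ(h)`. -/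
theorem thetaH_fourier_weyl (hm : m ≠ 0) (Φ : 𝓢(V, ℂ)) (h : Heis V) :
    thetaH V (PoissonSummation.dualLattice L) m (𝓕 Φ) (Heis.weyl m hm h) =
      ((ZLattice.covolume L : ℝ) : ℂ) * thetaH V L m Φ h := by
  rw [thetaH, thetaH, ← PoissonSummation.tsum_dualLattice_fourier L (repCLM V m h Φ)]
  exact tsum_congr fun w => by rw [fourier_repCLM]

/-- Self-dual lattices: `Θ_{𝓕Φ}(σ_m h) = Θ_Φ(h)` — the theta function on the Heisenberg group is `σ`-EQUIVARIANT under
the Fourier transform. -/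
theorem thetaH_fourier_weyl_of_dualLattice_eq (hL : PoissonSummation.dualLattice L = L) (hm : m ≠ 0)
    (Φ : 𝓢(V, ℂ)) (h : Heis V) : thetaH V L m (𝓕 Φ) (Heis.weyl m hm h) = thetaH V L m Φ h := by
  rw [← thetaH_congr V L m hL, thetaH_fourier_weyl, PoissonSummation.covolume_eq_one_of_dualLattice_eq L hL,
    Complex.ofReal_one, one_mul, thetaH_congr V L m hL]

omit [MeasurableSpace V] [BorelSpace V] in
/-- `σ_m` carries the arithmetic subgroup of `L` into that of `L*` (it swaps the rôles of `L` and `L*`; `L** = L`). -/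
theorem weyl_mem_arith (hm : m ≠ 0) {h : Heis V} (hh : h ∈ arith V L m) :
    Heis.weyl m hm h ∈ arith V (PoissonSummation.dualLattice L) m := by
  have hm' : (m : ℝ) ≠ 0 := Int.cast_ne_zero.mpr hm
  obtain ⟨ha, hb, hu⟩ := hh
  refine ⟨?_, ?_, ?_⟩
  · simpa only [Heis.weyl_a] using hb
  · rw [Heis.weyl_b, smul_neg, smul_smul, mul_inv_cancel₀ hm', one_smul, PoissonSummation.dualLattice_dualLattice]
    exact L.neg_mem ha
  · have h1 := fourierChar_inner_eq_one_of_mem_dualLattice V L hb ⟨h.a, ha⟩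
    rw [real_inner_smul_left, real_inner_comm h.a h.b] at h1
    rw [Heis.weyl_u, mul_zpow, hu, one_mul, ← AddChar.map_zsmul_eq_zpow, zsmul_eq_mul]
    exact h1

omit [MeasurableSpace V] [BorelSpace V] in
/-- (Ported verbatim from the HodgeCMPerL package; no docstring in the source.) -/
theorem weyl_mem_arith_of_dualLattice_eq (hL : PoissonSummation.dualLattice L = L) (hm : m ≠ 0) {h : Heis V}
    (hh : h ∈ arith V L m) : Heis.weyl m hm h ∈ arith V L m := by
  have h1 := weyl_mem_arith V L m hm hh
  rwa [show arith V (PoissonSummation.dualLattice L) m = arith V L m by rw [hL]] at h1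

omit [FiniteDimensional ℝ V] [MeasurableSpace V] [BorelSpace V] [DiscreteTopology L] [IsZLattice ℝ L] in
/-- (Ported verbatim from the HodgeCMPerL package; no docstring in the source.) -/
theorem weyl_inv_mul_center_inv (hm : m ≠ 0) (h : Heis V) (z : Circle) :
    (Heis.weyl m hm h)⁻¹ * Heis.center z⁻¹ = Heis.weyl m hm (h⁻¹ * Heis.center z⁻¹) := by
  rw [map_mul, Heis.weyl_center, map_inv (Heis.weyl m hm) h]

/-- On prl1-g4's record: the descended theta kernels of the `L*`-model at `𝓕 Φ` and of the `L`-model at `Φ` agree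
along `σ_m` up to `covol(V/L)`. -/
theorem heisenbergModel_θ_mk_fourier (hm : m ≠ 0) (Γ : Subgroup Circle) (hΓ : ∀ u ∈ Γ, u ^ m = 1)
    (Φ : 𝓢(V, ℂ)) (h : Heis V) (z : Circle) :
    (heisenbergModel V (PoissonSummation.dualLattice L) m Γ hΓ).θ ⟨(𝓕 Φ : 𝓢(V, ℂ)), Set.mem_univ _⟩
        (QuotientGroup.mk (Heis.weyl m hm h), QuotientGroup.mk z) =
      ((ZLattice.covolume L : ℝ) : ℂ) *
        (heisenbergModel V L m Γ hΓ).θ ⟨Φ, Set.mem_univ _⟩ (QuotientGroup.mk h, QuotientGroup.mk z) := by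
  rw [heisenbergModel_θ_mk, heisenbergModel_θ_mk, weyl_inv_mul_center_inv V m hm h z]
  exact thetaH_fourier_weyl V L m hm Φ _

/-- Self-dual `L`: the descended theta kernel is `σ_m`-equivariant under `Φ ↦ 𝓕 Φ`. -/
theorem heisenbergModel_θ_mk_fourier_of_dualLattice_eq (hL : PoissonSummation.dualLattice L = L) (hm : m ≠ 0)
    (Γ : Subgroup Circle) (hΓ : ∀ u ∈ Γ, u ^ m = 1) (Φ : 𝓢(V, ℂ)) (h : Heis V) (z : Circle) :
    (heisenbergModel V L m Γ hΓ).θ ⟨(𝓕 Φ : 𝓢(V, ℂ)), Set.mem_univ _⟩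
        (QuotientGroup.mk (Heis.weyl m hm h), QuotientGroup.mk z) =
      (heisenbergModel V L m Γ hΓ).θ ⟨Φ, Set.mem_univ _⟩ (QuotientGroup.mk h, QuotientGroup.mk z) := by
  rw [heisenbergModel_θ_mk, heisenbergModel_θ_mk, weyl_inv_mul_center_inv V m hm h z]
  exact thetaH_fourier_weyl_of_dualLattice_eq V L m hL hm Φ _

end ThetaFE

end SchwartzWeil
end HodgeCM

end
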